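import Summits.QuantumFields.YangMills.Theorems.UnitScaleTiltProp7OneFormGreenBlockGradient
import Summits.QuantumFields.YangMills.Theorems.UnitScaleTiltProp7OneFormGreenBlockDivergenceKFree
import HarnessLib

/-!
# Route `UnitScaleTilt`, crux K1 «MinimiserStabilityRegPr» (stmt-QuantumFields-19200), EX face, norm_G road — **(∇0)-K: THE (115)-GRADIENT ROW OF `G₀` ON SUP-BOUNDED SOURCES,
# UNDER `Lift`, WITH A MEMBER-FREE CONSTANT** (F2 of the (∇0) triple; the K-free member edition of ✓`Prop7OneFormGreenBlockGradient.norm_nabla115_GT_le_of_sup`).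
Cell `ym3-torus` (HUMAN RULING D-0037; rung R3 = SU(2) YM₃ on T³ — NOT d = 4, NOT infinite volume, NOT a mass gap, NOT Clay).  Width seat `ym3-torus-px21` (gen 15).
THEOREMS ONLY (0 `def`, 0 `sorry`); `--supports stmt-QuantumFields-19200 --as helper`; count-neutral.

WHAT IS PROVED (ns `Summit.QuantumFields.YangMills.Theorems.Prop7OneFormGreenBlockGradientKFree`).
* §1 `CN_mono` — monotonicity of the printed `C_∇` of (∇b)∕(∇0) in its member-dependent atoms (`A_V`, `e^{51κ₁}`, `e^{5κ₁}`, the two words) — pure reals, `gcongr`.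
* §2 ★★★ `gradient_GT_DeltaEtaSlot_kfree` — the HYPOTHESES of ✓(dκ)-K `Prop7OneFormGreenBlockDivergenceKFree.divergence_GT_DeltaEtaSlot_kfree` VERBATIM (`n < K`; `RegPr` + the three `ε₀`
  windows; `Lift`; `0 ≤ a ≤ a₁(c₀∕cB)ℓ³`; (γ) `hco`, `0 < γ`; `hk_D` in the `C_K·ℓ⁻³·e^{−δ_K·d}` currency; the budgets `r ≤ ¼`, `r ≤ δ_K∕2`, `ε ≤ ⅛`, `ε·C_V¹ ≤ γ∕8`, `r ≤ γε∕48`,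
  `r·T(a₁,C_K,δ_K) ≤ γ∕16`, `10⁵ε₀ ≤ γ∕16`; the no-wrap room; the K-free gradient margin `C_g·(48ε₀(6√2√10 + 6√2))·e^{51∕8} ≤ ½`) ⟹ **px17 g12's `hG0` TEXT**
  `∀ X s, (∀ b, ‖X b‖ ≤ s) → ‖nabla115 (((F.L:ℝ)⁻¹)^(K−n)) (bgOfCfg F K U₀) (fun q => toL2⁻¹(G₀(toL2 X)) (bondEquiv⁻¹ q))‖ ≤ (C_∇⋆ · (2(1+1∕κ₁))³) * s` with the MEMBER-FREE
  `C_∇⋆(γ, C_K, δ_K, a₁, r, ε₀; C_g, C)` printed below (= (dκ)-K's `C_D⋆` with the leading `3·e^{4∕8}` struck; no `ℓ`, `c₀`, `cB`, `a`, `K`) and `κ₁ = min r ¼ ∕ 2`.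
  PROOF: the A2i∕D1 feed of (dκ)-K verbatim (`PosOnto` ⟸ (γ) + ✓`surjective_Qk_of_regPr`; (θ_V) ⟸ ✓`hVconj_phaseClass_of_letters`; (C_V) ⟸ ✓`hVlow_abs_of_lift`; `hkQ` ⟸ ✓`hkQ_of_regPr`;
  the block VALUE letter ⟸ px16 ✓`norm_symm_GT_apply_le_of_blockSupport`, quantified over block-supported sources), then F1 §3, then §1 with (dκ)-K's numerics
  (✓`twoA₂_le_kfree`, ✓`words_le_kfree`, ✓`exp_mul_kappa_le`); `0 ≤ A_V` is read off the value letter at the ZERO source, `0 ≤ s` off `hX`.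
HEARTBEATS (README rule, disclosed): §2 carries a decl-local `set_option maxHeartbeats 400000 in` exactly as its sibling ✓(dκ)-K (`isDefEq` on the fed 4-kchar constants); §1 default.
HYP-SAT (★★OWNER RULING №42): as (dκ)-K — (γ) `hco`, `hk_D`, `Lift`, `RegPr` are the EX face's standing letters (inhabited by ✓`hco_DeltaEtaSlot_exists`, ✓`kernelRow349_allMembers_exists`);
the budgets are satisfiable real inequalities on free parameters (px16's D2 (c) family chooses them); `hroom` CHAIR WORD №1 class; conclusion non-vacuous; no `Prop` placeholder.
HONEST SCOPE.  Re-knit + real arithmetic; CONDITIONAL on the displayed letters; nothing of (∇1), `norm_G`, `h133`, the EX rows, EX, 19200 or the rung is proved here; the Yang–Mills mass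
gap is NOT proved.
References: T. Bałaban, CMP **99** (1985) 389–434 [Balaban1985BackgroundPropagators] ((3.3) p.391, Thm 3.1 (3.42)–(3.47) pp.397–399, (3.49) p.399, Thm 3.11 p.416, Thm 3.12 p.423);
CMP **102** (1985) 277–309 [Balaban1985Variational] ((19) p.281, (115)–(117) pp.294–295).
-/

set_option autoImplicit false

noncomputable section

open scoped Matrix.Norms.L2Operator BigOperators InnerProductSpace ComplexConjugate

namespace Summit.QuantumFields.YangMills.Theorems.Prop7OneFormGreenBlockGradientKFree

open Literature.MathematicalPhysics.QuantumFieldTheory.Balaban1983to89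
open Literature.MathematicalPhysics.QuantumFieldTheory.Balaban1983to89.T3ContinuumYM3Torus
open Literature.MathematicalPhysics.QuantumFieldTheory.Balaban1983to89.T3PrintedRegularMinimiser (RegPr)
open B15DeterminingSets (embIter)
open T3SectALandauChart (formComp bgUnits eta eta_pos)
open B9SectCLatticeCarrier (Bond)
open B9Eq311L2Pairing (WL2)
open B11Eq103H1Complex (BondL2K)
open B5Eq118OneStroke (iterBlockOf)
open Summit.QuantumFields.YangMills.Theorems.Prop8Chart (emlIterU)
open Summit.QuantumFields.YangMills.Theorems.Prop7SectET3Transport (periodsT3 bondEquiv)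
open Summit.QuantumFields.YangMills.Theorems.Prop7SectET3HilbertLetters (W₂ frobEquiv toL2 toL2S DL2 DstarL2)
open Summit.QuantumFields.YangMills.Theorems.Prop7SectET3WilsonHessian (DeltaEtaSlot)
open Summit.QuantumFields.YangMills.Theorems.Prop7SectET3GaugeProjector (RS)
open Summit.QuantumFields.YangMills.Theorems.Prop7SectET3CurvedPropagators (laplaceA Qk GT PosOnto)
open Summit.QuantumFields.YangMills.Theorems.Prop7OneFormAgmonPhaseClass (hVconj_phaseClass_of_letters)
open Summit.QuantumFields.YangMills.Theorems.Prop7QkPenaltyKernelRowOfRegPr (hkQ_of_regPr)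
open Summit.QuantumFields.YangMills.Theorems.Prop7QkAdjointSupRowOfRegPr (norm_Qk_le_of_regPr)
open Summit.QuantumFields.YangMills.Theorems.Prop7QkOntoOfRegPr (surjective_Qk_of_regPr)
open Summit.QuantumFields.YangMills.Theorems.Prop7OneFormRemainderFloorOfLift (hVlow_abs_of_lift)
open Summit.QuantumFields.YangMills.Theorems.Prop7OneFormGreenSupBound (norm_symm_GT_apply_le_of_blockSupport)
open Summit.QuantumFields.YangMills.Theorems.Prop7OneFormGreenKFreeNumerics (sqrt_vol_mul_sqrt_mass_eq twoA₂_le_kfree thetaV_le_kfree hsmall_le_half rbudget_le theta_ge_half_of_budgets CV_abs_le)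
open Summit.QuantumFields.YangMills.Theorems.Prop7CurvedMemberLocalGradient (exists_curved_localGradient)
open Summit.QuantumFields.YangMills.Theorems.AxialGaugeChartGlue (norm_bgOfCfg_axialT_sub_le)
open B11Eq111FrakG (nabla115)
open Summit.QuantumFields.YangMills.Theorems.Prop7SectET3Transport (bgOfCfg)
open Summit.QuantumFields.YangMills.Theorems.Prop7OneFormGreenBlockDivergenceKFree (words_le_kfree exp_mul_kappa_le)
open Summit.QuantumFields.YangMills.Theorems.Prop7OneFormGreenBlockGradient (norm_nabla115_GT_le_of_sup)

/-! ## §1 Numerics (pure reals): monotonicity of `C_∇` -/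

/-- `C_∇` is monotone in its member-dependent atoms (`A_V`, `e^{51κ₁}`, `e^{5κ₁}`, the (D)-word, the (Q)-word). [folklore] -/
theorem CN_mono {Cg cε ε₀ AV e51 e5 WD WQ AV' e51' e5' WD' WQ' : ℝ} (hCg : 0 ≤ Cg) (hcε : 0 ≤ cε) (hε₀ : 0 ≤ ε₀)
    (hAV : 0 ≤ AV) (h51 : 0 ≤ e51) (h5 : 0 ≤ e5) (hWD : 0 ≤ WD) (hWQ : 0 ≤ WQ)
    (lAV : AV ≤ AV') (l51 : e51 ≤ e51') (l5 : e5 ≤ e5') (lWD : WD ≤ WD') (lWQ : WQ ≤ WQ') :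
    (2 * ((Cg * (((Real.sqrt 2 * AV) * e51) * cε + (Real.sqrt 2 * ((32 * ε₀ * (AV * e5)) + WD + WQ + 1)) * e51)
        + 2 * Real.sqrt 2 * (48 * ε₀) * ((Real.sqrt 2 * AV) * e51))))
      ≤ (2 * ((Cg * (((Real.sqrt 2 * AV') * e51') * cε + (Real.sqrt 2 * ((32 * ε₀ * (AV' * e5')) + WD' + WQ' + 1)) * e51')
        + 2 * Real.sqrt 2 * (48 * ε₀) * ((Real.sqrt 2 * AV') * e51')))) := by
  have hAV' : 0 ≤ AV' := hAV.trans lAV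
  have h51' : 0 ≤ e51' := h51.trans l51
  have h5' : 0 ≤ e5' := h5.trans l5
  have hWD' : 0 ≤ WD' := hWD.trans lWD
  have hWQ' : 0 ≤ WQ' := hWQ.trans lWQ
  gcongr

/-! ## §2 ★★★ The K-free member edition of (∇0) under `Lift` -/

section Member

variable (F : T3Family) {n K : ℕ} (h : n ≤ K) (c₀ cB : ℝ) [Fact (0 < c₀)] [Fact (0 < cB)]

set_option maxHeartbeats 400000 in
/-- ★★★ **(∇0)-K: THE (115)-GRADIENT ROW OF `G₀` ON SUP-BOUNDED SOURCES, UNDER `Lift`, MEMBER-FREE CONSTANT** — F1 ✓`norm_nabla115_GT_le_of_sup` with every letter FED as in ✓(dκ)-K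
`divergence_GT_DeltaEtaSlot_kfree` (hypotheses VERBATIM), concluding px17 g12's `hG0` binder text with `BG := C_∇⋆·(2(1+1∕κ₁))³`, `κ₁ = min r ¼ ∕ 2`, `C_∇⋆` member-free (printed).
[cite: Balaban1985BackgroundPropagators, (3.3) p.391, Thm 3.1 (3.42)–(3.47) pp.397–399, (3.49) p.399, Thm 3.11 p.416, Thm 3.12 p.423; Balaban1985Variational, (19) p.281, (115)–(117) pp.294–295] -/
theorem gradient_GT_DeltaEtaSlot_kfree (hnK : n < K) {ε₀ : ℝ} (hε₀ : 0 < ε₀) (hWε : 10 ^ 12 * (F.L : ℝ) ^ 3 * ε₀ ≤ 1)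
    (hε10 : 10 ^ 10 * (F.L : ℝ) ^ 6 * ε₀ ≤ 1) (hwin : 13 * 10 ^ 14 * (F.L : ℝ) ^ 3 * ε₀ ≤ 1)
    (U₀ : GaugeField (F.P K) 0 (Matrix.specialUnitaryGroup (Fin 2) ℂ)) (hreg : RegPr F n K ε₀ U₀)
    (hlift : ∀ cf : Site (F.P K) (K - n) → Matrix (Fin 2) (Fin 2) ℂ,
        (∀ e : PBond (F.P K) (K - n), cf e.src = ((emlIterU (K - n) (bgUnits F K U₀) e : (Matrix (Fin 2) (Fin 2) ℂ)ˣ) : Matrix (Fin 2) (Fin 2) ℂ) * cf e.tgt *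
          (((emlIterU (K - n) (bgUnits F K U₀) e)⁻¹ : (Matrix (Fin 2) (Fin 2) ℂ)ˣ) : Matrix (Fin 2) (Fin 2) ℂ)) →
        ∃ l₀ : Site (F.P K) 0 → Matrix (Fin 2) (Fin 2) ℂ,
          (∀ b : PBond (F.P K) 0, l₀ b.src = ((bgUnits F K U₀ b : (Matrix (Fin 2) (Fin 2) ℂ)ˣ) : Matrix (Fin 2) (Fin 2) ℂ) * l₀ b.tgt * (((bgUnits F K U₀ b)⁻¹ : (Matrix (Fin 2) (Fin 2) ℂ)ˣ) : Matrix (Fin 2) (Fin 2) ℂ)) ∧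
          ∀ y : Site (F.P K) (K - n), l₀ (embIter (K - n) y) = cf y)
    {a a₁ : ℝ} (ha : 0 ≤ a) (ha₁ : a ≤ a₁ * (c₀ / cB) * ((F.L : ℝ) ^ (K - n)) ^ 3)
    {γ : ℝ} (hγ : 0 < γ) (hco : ∀ v : BondL2K ℂ 3 (periodsT3 F K) c₀ W₂, γ * ‖v‖ ^ 2 ≤ RCLike.re ⟪v, laplaceA F n K h c₀ cB a (DeltaEtaSlot F n K c₀) U₀ v⟫_ℂ)
    {CK δK : ℝ} (hCK : 0 ≤ CK) (hδK : 0 < δK)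
    (hkD : ∀ (b : PBond (F.P K) 0) (Z : Matrix (Fin 2) (Fin 2) ℂ) (bd : PBond (F.P K) 0),
      ‖(toL2 F K c₀).symm (DL2 F n K c₀ U₀ (DstarL2 F n K c₀ U₀ (toL2 F K c₀ (Pi.single b Z))
          - RS F n K h c₀ cB U₀ (DstarL2 F n K c₀ U₀ (toL2 F K c₀ (Pi.single b Z))))) bd‖
        ≤ CK * ((F.L : ℝ) ^ (K - n))⁻¹ ^ 3 * Real.exp (-(δK * (Site.tdist (P := F.P K) (iterBlockOf (K - n) b.src) (iterBlockOf (K - n) bd.src) : ℝ))) * ‖Z‖)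
    {r ε : ℝ} (hr : 0 < r) (hr4 : r ≤ 1 / 4) (hrδ : r ≤ δK / 2) (hε : 0 < ε) (hε8 : ε ≤ 1 / 8)
    (hεC : ε * (32 * Real.sqrt 2 * 648 + (33 / 8 : ℝ) ^ 2 * (600 * (27 / 4 : ℝ) ^ 6)) ≤ γ / 8) (hrγ : r ≤ γ * ε / 48)
    (hrT : r * (5000 * a₁ + 27 * Real.sqrt 2 * CK * (2 * (1 + 4 / δK)) ^ 3 / min 1 (δK / 4)) ≤ γ / 16) (hαγ : 10 ^ 5 * ε₀ ≤ γ / 16)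
    (hroom : 2 * (12 * F.L ^ (K - n) + 5) ≤ (F.P K).sitesPerDir 0)
    (hsmall : exists_curved_localGradient.choose * ((48 * ε₀) * (6 * Real.sqrt 2 * Real.sqrt 10 + 6 * Real.sqrt 2)) * Real.exp (51 / 8) ≤ 1 / 2) :
    ∀ (X : PBond (F.P K) 0 → Matrix (Fin 2) (Fin 2) ℂ) (s : ℝ), (∀ b, ‖X b‖ ≤ s) →
      ‖nabla115 (((F.L : ℝ)⁻¹) ^ (K - n)) (bgOfCfg F K U₀)
          (fun q : Bond 3 (periodsT3 F K) => (toL2 F K c₀).symm (GT F n K h c₀ cB a (DeltaEtaSlot F n K c₀) U₀ (toL2 F K c₀ X)) ((bondEquiv F K).symm q))‖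
        ≤ ((2 * ((exists_curved_localGradient.choose * (((Real.sqrt 2 * (2 * ((Real.sqrt 2 + Real.sqrt 2 * ((50 * a₁ * Real.exp δK + CK) * (3 * Real.sqrt 2) * (Real.exp (6 * r) * (2 / γ)) * (2 * (1 + 2 / δK)) ^ 3)) * (8 * Real.exp (3 * r)) * 14 + 36 * (Real.sqrt (8 * Real.exp (3 * r) * (2 * (1 + 1 / r)) ^ 3) * (Real.exp (6 * r) * (2 / γ)))))) * Real.exp (51 / 8)) * (2 + 2 * Real.sqrt 2 * (4 * ε₀ * (3 + 2457 * norm_bgOfCfg_axialT_sub_le.choose)) + (24 * Real.sqrt 10 + 48) * (48 * ε₀) ^ 2) + (Real.sqrt 2 * ((32 * ε₀ * ((2 * ((Real.sqrt 2 + Real.sqrt 2 * ((50 * a₁ * Real.exp δK + CK) * (3 * Real.sqrt 2) * (Real.exp (6 * r) * (2 / γ)) * (2 * (1 + 2 / δK)) ^ 3)) * (8 * Real.exp (3 * r)) * 14 + 36 * (Real.sqrt (8 * Real.exp (3 * r) * (2 * (1 + 1 / r)) ^ 3) * (Real.exp (6 * r) * (2 / γ))))) * Real.exp (5 / 8)))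 + (CK * (3 * Real.sqrt 2) * (Real.exp (6 * r) * (2 / γ)) * (2 * (1 + 2 / δK)) ^ 3) + ((50 * a₁ * Real.exp δK) * (3 * Real.sqrt 2) * (Real.exp (6 * r) * (2 / γ)) * (2 * (1 + 2 / δK)) ^ 3) + 1)) * Real.exp (51 / 8)) + 2 * Real.sqrt 2 * (48 * ε₀) * ((Real.sqrt 2 * (2 * ((Real.sqrt 2 + Real.sqrt 2 * ((50 * a₁ * Real.exp δK + CK) * (3 * Real.sqrt 2) * (Real.exp (6 * r) * (2 / γ)) * (2 * (1 + 2 / δK)) ^ 3)) * (8 * Real.exp (3 * r)) * 14 + 36 * (Real.sqrt (8 * Real.exp (3 * r) * (2 * (1 + 1 / r)) ^ 3) * (Real.exp (6 * r) * (2 / γ)))))) * Real.exp (51 / 8))))) * (2 * (1 + 1 / (min r (1 / 4) / 2))) ^ 3) * s := by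
  intro X s hX
  have hc₀ : 0 < c₀ := Fact.out
  have hcB : 0 < cB := Fact.out
  have hd : (F.P K).d = 3 := rfl
  have hL2 : (2 : ℝ) ≤ F.L := by exact_mod_cast F.hL.2
  have hLr : (1 : ℝ) ≤ F.L := le_trans one_le_two hL2
  have hε5 : ε₀ ≤ (10 : ℝ)⁻¹ ^ 5 := by
    have h1 : 10 ^ 12 * ε₀ ≤ 10 ^ 12 * (F.L : ℝ) ^ 3 * ε₀ := by
      have hL3 : (1 : ℝ) ≤ (F.L : ℝ) ^ 3 := one_le_pow₀ hLr
      nlinarith [hε₀.le]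
    have h2 : 10 ^ 12 * ε₀ ≤ 1 := h1.trans hWε
    rw [inv_pow]
    rw [le_inv_comm₀ hε₀ (by positivity)]
    calc (10 : ℝ) ^ 5 ≤ 10 ^ 12 := by norm_num
      _ ≤ ε₀⁻¹ := by rw [le_inv_comm₀ (by positivity) hε₀]; exact (le_div_iff₀' (by positivity)).mpr (by linarith) |>.trans (le_of_eq (one_div _))
  have hε1 : ε₀ ≤ 1 := hε5.trans (by norm_num)
  have hεle1 : ε ≤ 1 := by linarith
  -- the four budgets ⟹ `Θ ≥ γ∕2`; the value window
  have hθ := thetaV_le_kfree hd hLr (K - n) hc₀ hcB ha ha₁ hCK hδK hr hr4 hrδ hε₀.le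
  have hθ8 := hθ.trans (show r * (5000 * a₁ + 27 * Real.sqrt 2 * CK * (2 * (1 + 4 / δK)) ^ 3 / min 1 (δK / 4)) + 10 ^ 5 * ε₀ ≤ γ / 8 by linarith)
  have hεC' := (mul_le_mul_of_nonneg_left (CV_abs_le hd hε1) hε.le).trans hεC
  have hR := (rbudget_le hγ.le hr hr4 hε (by linarith) hrγ).trans (show γ / 16 ≤ γ / 8 by linarith [hγ.le])
  have hΘ := theta_ge_half_of_budgets hγ.le hε8 hεC' hR hθ8
  have hΘpos := lt_of_lt_of_le (by positivity : (0 : ℝ) < γ / 2) hΘ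
  have hS := hsmall_le_half hr4 hε₀.le hε5
  have hSV := lt_of_le_of_lt hS (by norm_num : (1 : ℝ) / 2 < 1)
  have hrμ : r < δK := by linarith
  have hCkD : 0 ≤ CK * ((F.L : ℝ) ^ (K - n))⁻¹ ^ 3 := by positivity
  have hdr : 0 < δK - r := by linarith
  have hS30 : 0 ≤ (2 * (1 + 1 / (δK - r))) ^ 3 := pow_nonneg (by have := div_nonneg zero_le_one hdr.le; linarith) 3
  have hCg := exists_curved_localGradient.choose_spec.1
  have hC := norm_bgOfCfg_axialT_sub_le.choose_spec.1
  have e4B : (4 : ℝ) * ((Real.sqrt 2 + Real.sqrt 2 * ((50 * a₁ * Real.exp δK + CK) * (3 * Real.sqrt 2) * (Real.exp (6 * r) * (2 / γ)) * (2 * (1 + 2 / δK)) ^ 3)) * (8 * Real.exp (3 * r)) * 14 + 36 * (Real.sqrt (8 * Real.exp (3 * r) * (2 * (1 + 1 / r)) ^ 3) * (Real.exp (6 * r) * (2 / γ)))) = 2 * (2 * ((Real.sqrt 2 + Real.sqrt 2 * ((50 * a₁ * Real.exp δK + CK) * (3 * Real.sqrt 2) * (Real.exp (6 * r) * (2 /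 γ)) * (2 * (1 + 2 / δK)) ^ 3)) * (8 * Real.exp (3 * r)) * 14 + 36 * (Real.sqrt (8 * Real.exp (3 * r) * (2 * (1 + 1 / r)) ^ 3) * (Real.exp (6 * r) * (2 / γ))))) := by ring
  -- numerics: every member-dependent atom of `C_D` under its K-free majorant (pure reals, before the big terms enter the context)
  have hA := twoA₂_le_kfree hd hLr (K - n) hc₀ hcB ha ha₁ hCK hδK hr hr4 hrδ hγ hΘ hε₀.le hε5
  have hAV := le_of_mul_le_mul_left (hA.trans_eq e4B) (two_pos : (0 : ℝ) < 2)
  obtain ⟨hWD, hWQ⟩ := words_le_kfree hd hLr (K - n) hc₀ hcB ha ha₁ hCK hδK hr hrδ hγ hΘ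
  -- the fed letters (A2i's knit)
  have hp : PosOnto F n K h c₀ cB a (DeltaEtaSlot F n K c₀) U₀ :=
    ⟨fun v hv => lt_of_lt_of_le (mul_pos hγ (pow_pos (norm_pos_iff.mpr hv) 2)) (hco v), surjective_Qk_of_regPr F h hnK c₀ cB hreg hwin⟩
  have hQ : ∀ v : BondL2K ℂ 3 (periodsT3 F K) c₀ W₂, ‖Qk F n K h c₀ cB U₀ v‖ ≤ (6 * Real.sqrt (cB / c₀) * Real.sqrt (((F.L : ℝ) ^ (K - n))⁻¹ ^ 3)) * ‖v‖ :=
    fun v => norm_Qk_le_of_regPr F h c₀ cB hε₀ hε10 hWε U₀ hreg v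
  have hVconj := hVconj_phaseClass_of_letters F h c₀ cB (a := a) hε₀ hε10 hWε U₀ hreg ha hr.le hrμ hCkD hkD hQ
  have hVlow := hVlow_abs_of_lift F h c₀ cB (a := a) hnK hε₀ hWε U₀ hreg ha hlift
  have hkQ := hkQ_of_regPr F h c₀ cB hε₀ hε10 hWε U₀ hreg ha (le_of_lt (hr.trans hrμ))
  -- the gradient margin at `κ₁ ≤ ⅛`
  have hsmallκ : exists_curved_localGradient.choose * ((48 * ε₀) * (6 * Real.sqrt 2 * Real.sqrt 10 + 6 * Real.sqrt 2)) * Real.exp (51 * (min r (1 / 4) / 2)) ≤ 1 / 2 :=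
    (mul_le_mul_of_nonneg_left (exp_mul_kappa_le (r := r) (by norm_num : (0 : ℝ) ≤ 51))
      (mul_nonneg exists_curved_localGradient.choose_spec.1 (by positivity))).trans hsmall
  -- the decayed VALUE row (px16 §3) as a letter quantified over block-supported sources, fed
  have hvalb := fun (Y : PBond (F.P K) 0 → Matrix (Fin 2) (Fin 2) ℂ) (z : Site (F.P K) (K - n)) (hYz : ∀ b, Y b ≠ 0 → iterBlockOf (K - n) b.src = z)
      (t : ℝ) (ht : 0 ≤ t) (hY : ∀ b, ‖Y b‖ ≤ t) (bd : PBond (F.P K) 0) =>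
    norm_symm_GT_apply_le_of_blockSupport (h := h) (cB := cB) (a := a) hnK.le hε₀.le U₀ hreg hp hr hε hεle1 hco hVlow hVconj hΘpos hCkD
      (by positivity) hrμ hkD hkQ hSV Y z hYz ht hY bd
  -- (∇0) at the member with every letter fed
  have main := norm_nabla115_GT_le_of_sup F c₀ U₀ (h := h) (cB := cB) (a := a) hnK.le hε₀ hε1 hreg hp hr hε hεle1 hco hVlow hVconj hΘpos
    hCkD (by positivity) hrμ hkD hkQ hvalb hroom hsmallκ X s hX
  -- `0 ≤ s` off `hX`; the sign of `A_V` off the value letter at the ZERO source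
  obtain ⟨b₀⟩ : Nonempty (PBond (F.P K) 0) := ⟨⟨Classical.arbitrary _, ⟨0, by rw [T3Family.P_d]; norm_num⟩⟩⟩
  have hs : 0 ≤ s := (norm_nonneg _).trans (hX b₀)
  have hb := hvalb (fun _ => 0) (iterBlockOf (K - n) b₀.src) (fun b hb => absurd rfl hb) 1 zero_le_one (fun _ => by rw [norm_zero]; exact zero_le_one) b₀
  rw [one_mul] at hb
  have hAV0 := (mul_nonneg_iff_of_pos_right (Real.exp_pos _)).mp ((norm_nonneg _).trans hb)
  have hV0 : 0 ≤ (2 * (1 + 1 / (min r (1 / 4) / 2))) ^ 3 := by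
    have hk1 : 0 < (min r (1 / 4) / 2) := by have := lt_min hr (by norm_num : (0 : ℝ) < 1 / 4); positivity
    positivity
  have mono := CN_mono (Cg := exists_curved_localGradient.choose) (ε₀ := ε₀)
    (cε := (2 + 2 * Real.sqrt 2 * (4 * ε₀ * (3 + 2457 * norm_bgOfCfg_axialT_sub_le.choose)) + (24 * Real.sqrt 10 + 48) * (48 * ε₀) ^ 2))
    (lAV := hAV) (lWD := hWD) (lWQ := hWQ)
    (l51 := exp_mul_kappa_le (r := r) (by norm_num : (0 : ℝ) ≤ 51))
    (l5 := exp_mul_kappa_le (r := r) (by norm_num : (0 : ℝ) ≤ 5))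
    hCg (by positivity) hε₀.le hAV0 (Real.exp_pos _).le (Real.exp_pos _).le
    (by exact mul_nonneg (mul_nonneg (mul_nonneg hCkD (Real.sqrt_nonneg _)) (div_nonneg (by positivity) hΘpos.le)) hS30)
    (by exact mul_nonneg (mul_nonneg (by positivity) (div_nonneg (by positivity) hΘpos.le)) hS30)
  exact main.trans (mul_le_mul_of_nonneg_right (mul_le_mul_of_nonneg_right mono hV0) hs)

end Member

end Summit.QuantumFields.YangMills.Theorems.Prop7OneFormGreenBlockGradientKFree

end
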